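import Summits.BirchSwinnertonDyer.BirchSwinnertonDyer.Theorems.CMKolyvaginAtInertTwoPairOfRatCarrierAtTwo
import Summits.BirchSwinnertonDyer.BirchSwinnertonDyer.Theorems.GenusKolyvaginAtTwoVisiblePairAtTwoDefs
import Literature.NumberTheory.EllipticCurves.HeegnerPointsKolyvaginSplitDescentPairData
import HarnessLib

/-!
# Route `CMKolyvaginAtInertTwo`, crux `CMKolyvaginExactAtInertTwo` (stmt-BirchSwinnertonDyer-24277):
# path (β) of the T2 assembly — the `ℚ`-PAIR DATA `D.toSplitData` and the map `f = (res, ψ ∘ res)`: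
# the compatibilities `heig`, `hΔ'`, `hKol`, `hSdε`, `hxSd`, `hJ₁ε`/`hJ₂ε`, `hSel` of the kill-clause telescope

Seat `bsd-line-cmk2-p1` g17 (cell `bsd-print-cf2`); helper (`--supports stmt-BirchSwinnertonDyer-24277`).
THEOREMS ONLY: no definition, no named fact, no `sorry`; no item is closed; BSD is not proved by this.

KERNEL-STATUS-p2-port.md §17.4. The pair telescope `card_mul_card_le_two_pow_two_mul_of_injective_of_kill`
(this seat) takes split descent data `Sd` on a carrier `V'` with an injective `f : V' →+ PairV W c M ε` and
the compatibilities `heig` (`Sd.eig e = f⁻¹(pairEig e)` for EVERY `e : ℤ`), `hΔ'`, `hA`, `hKol`, `hSdε`,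
plus `hxSd`, `hJ₁ε`, `hJ₂ε`, `hSel` for the injections `J₁ = (·, 0)`, `J₂ = (0, ·)`. On path (β) the carrier is
`V' = H¹(ℚ, E[2^M]) × H¹(ℚ, E^{(d_K)}[2^M])`, `Sd := D.toSplitData` for the Literature data carrier
`D : KolyvaginDescent.PairDataM …` (p711760), and `f` is `exists_pairOfRat`'s `(res, hPsiKT ∘ res)` (p691323,
`c = σ₀ = sigmaQ`, `ε = 1`). This file discharges the `f`-compatibilities that need no arithmetic beyond
`E(K)[2^M] = 0`:

* `mem_toSplitData_eig_iff_mem_pairEig` — **`heig`** for every `e : ℤ` (signs: coordinate formulas +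
  `resTorsion(_twist)_injective_of_noTorsion`; junk `e`: both sides are `⊥`, `f` injective);
* `toSplitData_kol_iff_of_kol` — **`hKol`** when `D.Kol` is defined as the telescope's predicate;
* `fst_pairOfRat_inr_eq_zero`, `snd_pairOfRat_inl_eq_zero` — **`hJ₂ε`**, **`hJ₁ε`**;
* `inl_add_inr_mem_toSplitData_sel` — **`hSel`**; `toSplitData_x_eq_inl` — **`hxSd`**.

(`hΔ'` is definitional for `Δ' := (pairDelta …).comap f`; `hSdε` is `PairDataM.toSplitData_ε`; `hA` — the
LINE 6 dictionary at inert Kolyvagin primes — is the one arithmetic compatibility, left to its own file.)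

References: [Kolyvagin1989Izv] §3; [GrossLMS1991] §5 (5.1); [McCallumLMS1991] §5 Thm. 5.4.
-/

-- single-conjunct summit: `Summit.BirchSwinnertonDyer.BirchSwinnertonDyer.…` repeats the name by design
set_option linter.dupNamespace false
set_option autoImplicit false

noncomputable section

open scoped Classical
open WeierstrassCurve NumberField Field
open Literature.NumberTheory.GaloisRepresentations
open Literature.NumberTheory.EllipticCurves Literature.NumberTheory.EllipticCurves.KolyvaginDescent
open Summit.BirchSwinnertonDyer.BirchSwinnertonDyer.Theorems.GenusExact.EigenClassesFinite
open Summit.BirchSwinnertonDyer.BirchSwinnertonDyer.Theorems.GenusExact.VisiblePairAtTwo (twin lvl)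

namespace Summit.BirchSwinnertonDyer.BirchSwinnertonDyer.Theorems.KolyvaginPairDataTwo

variable (W : WeierstrassCurve ℚ) (K : Type) [Field K] [NumberField K]
  (h2 : Module.finrank ℚ K = 2) {θ : K} (hθ : θ ∉ Set.range (algebraMap ℚ K))
  (hd : θ ^ 2 = algebraMap ℚ K ((NumberField.discr K : ℤ) : ℚ)) (M : ℕ)

/-! ## `heig`: the parts of `D.toSplitData` are the preimages of the eigen-pair's parts -/

/-- **`heig` for the `ℚ`-pair carrier.** For `D : PairDataM (H¹(ℚ, E[2^M])) (H¹(ℚ, E^{(d_K)}[2^M])) Pl`, any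
additive `f` into `PairV W σ₀ M 1` with `(f v).1 = res v.1`, `(f v).2 = ψ (res v.2)` (as produced by
`exists_pairOfRat`) and `E(K)[2^M] = 0`: `v ∈ D.toSplitData.eig e ↔ f v ∈ pairEig W σ₀ M 1 e` for EVERY `e : ℤ`.
[cite: Kolyvagin1989Izv, §3] [cite: GrossLMS1991, §5 (5.1)] -/
theorem mem_toSplitData_eig_iff_mem_pairEig
    (hL : ∀ P : (W.baseChange K).toAffine.Point, ((2 ^ M : ℕ) : ℤ) • P = 0 → P = 0)
    {Pl : Type*} (D : PairDataM (galH1Torsion W (lvl M)) (galH1Torsion (twin W K) (lvl M)) Pl)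
    (f : galH1Torsion W (lvl M) × galH1Torsion (twin W K) (lvl M) →+ PairV W (sigmaQ K h2 hθ hd) M 1)
    (hf : Function.Injective f)
    (hf₁ : ∀ v, ((f v).1 : galH1Torsion (W.baseChange K) ((2 ^ M : ℕ) : ℤ)) = resTorsion W K (lvl M) v.1)
    (hf₂ : ∀ v, ((f v).2 : galH1Torsion (W.baseChange K) ((2 ^ M : ℕ) : ℤ)) =
      hPsiKT W K hθ hd (lvl M) (resTorsion (twin W K) K (lvl M) v.2))
    (e : ℤ) (v : galH1Torsion W (lvl M) × galH1Torsion (twin W K) (lvl M)) :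
    v ∈ D.toSplitData.eig e ↔ f v ∈ pairEig W (sigmaQ K h2 hθ hd) M 1 e := by
  by_cases he1 : e = 1
  · subst he1
    rw [PairDataM.mem_toSplitData_eig_one_iff, pairEig_self, AddSubgroup.mem_prod]
    simp only [AddSubgroup.mem_top, true_and, AddSubgroup.mem_bot]
    constructor
    · intro hv
      apply Subtype.ext
      rw [hf₂, hv, map_zero, map_zero]
      rfl
    · intro hv
      have h := hf₂ v
      rw [hv] at h
      have h0 : hPsiKT W K hθ hd (lvl M) (resTorsion (twin W K) K (lvl M) v.2) = 0 := h.symm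
      rw [map_eq_zero_iff _ (hPsiKT W K hθ hd (lvl M)).injective] at h0
      exact resTorsion_twist_injective_of_noTorsion W K h2 hθ hd (lvl M) hL (by rw [h0, map_zero])
  by_cases he2 : e = -1
  · subst he2
    rw [PairDataM.mem_toSplitData_eig_neg_one_iff, pairEig_neg W (sigmaQ K h2 hθ hd) M (Or.inl rfl),
      AddSubgroup.mem_prod]
    simp only [AddSubgroup.mem_top, and_true, AddSubgroup.mem_bot]
    constructor
    · intro hv
      apply Subtype.ext
      rw [hf₁, hv, map_zero]
      rfl
    · intro hv
      have h := hf₁ v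
      rw [hv] at h
      exact resTorsion_injective_of_noTorsion W K h2 hθ hd (lvl M) hL (by rw [← h, map_zero]; rfl)
  · -- junk sign: both sides are `⊥`
    rw [PairDataM.toSplitData_eig, PairDataM.eig_of_ne he1 he2, AddSubgroup.mem_bot, pairEig, if_neg he1,
      if_neg (by rwa [show -(1 : ℤ) = -1 from rfl]), AddSubgroup.mem_bot]
    constructor
    · rintro rfl
      exact map_zero f
    · intro h
      exact hf (by rw [h, map_zero])

/-! ## The bookkeeping compatibilities -/

/-- **`hKol`**: if `D.Kol` IS the telescope's predicate, `D.toSplitData.Kol ℓ ↔ …` by `Iff.rfl`.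
[cite: McCallumLMS1991, §3] -/
theorem toSplitData_kol_iff_of_kol {V₁ V₂ : Type*} [AddCommGroup V₁] [AddCommGroup V₂] {Pl : Type*}
    (D : PairDataM V₁ V₂ Pl) (Q : ℕ → Prop) (hQ : ∀ ℓ, D.Kol ℓ ↔ Q ℓ) (ℓ : ℕ) :
    D.toSplitData.Kol ℓ ↔ Q ℓ :=
  (D.toSplitData_kol_iff ℓ).trans (hQ ℓ)

/-- **`hJ₁ε`**: `(f (u, 0)).2 = 0`. [cite: Kolyvagin1989Izv, §3] -/
theorem snd_pairOfRat_inl_eq_zero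
    (f : galH1Torsion W (lvl M) × galH1Torsion (twin W K) (lvl M) →+ PairV W (sigmaQ K h2 hθ hd) M 1)
    (hf₂ : ∀ v, ((f v).2 : galH1Torsion (W.baseChange K) ((2 ^ M : ℕ) : ℤ)) =
      hPsiKT W K hθ hd (lvl M) (resTorsion (twin W K) K (lvl M) v.2))
    (u : galH1Torsion W (lvl M)) : (f (u, 0)).2 = 0 := by
  apply Subtype.ext
  rw [hf₂, map_zero, map_zero]
  rfl

/-- **`hJ₂ε`**: `(f (0, w)).1 = 0`. [cite: Kolyvagin1989Izv, §3] -/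
theorem fst_pairOfRat_inr_eq_zero
    (f : galH1Torsion W (lvl M) × galH1Torsion (twin W K) (lvl M) →+ PairV W (sigmaQ K h2 hθ hd) M 1)
    (hf₁ : ∀ v, ((f v).1 : galH1Torsion (W.baseChange K) ((2 ^ M : ℕ) : ℤ)) = resTorsion W K (lvl M) v.1)
    (w : galH1Torsion (twin W K) (lvl M)) : (f (0, w)).1 = 0 := by
  apply Subtype.ext
  rw [hf₁, map_zero]
  rfl

/-- **`hSel`**: `(u, 0) + (0, w) ∈ D.toSplitData.Sel` for `u ∈ D.Sel₁`, `w ∈ D.Sel₂`. [cite: McCallumLMS1991, §4] -/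
theorem inl_add_inr_mem_toSplitData_sel {V₁ V₂ : Type*} [AddCommGroup V₁] [AddCommGroup V₂] {Pl : Type*}
    (D : PairDataM V₁ V₂ Pl) (u : D.Sel₁) (w : D.Sel₂) :
    ((u : V₁), (0 : V₂)) + ((0 : V₁), (w : V₂)) ∈ D.toSplitData.Sel := by
  rw [PairDataM.mem_toSplitData_sel_iff, Prod.fst_add, Prod.snd_add, add_zero, zero_add]
  exact ⟨u.2, w.2⟩

/-- **`hxSd`**: `D.toSplitData.x = (x, 0)` is the image of `⟨D.x, D.x_mem⟩ : D.Sel₁` under `J₁ = (·, 0)`.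
[cite: McCallumLMS1991, Lemma 5.1] -/
theorem toSplitData_x_eq_inl {V₁ V₂ : Type*} [AddCommGroup V₁] [AddCommGroup V₂] {Pl : Type*}
    (D : PairDataM V₁ V₂ Pl) :
    D.toSplitData.x = (((⟨D.x, D.x_mem⟩ : D.Sel₁) : V₁), (0 : V₂)) :=
  D.toSplitData_x

/-- The two injections as additive maps: `J₁ = (ι₁, 0)`, `J₂ = (0, ι₂)` are injective and
`J₁ u + J₂ w = (u, w)`. [cite: Kolyvagin1989Izv, §3] -/
theorem inl_inr_injective {V₁ V₂ : Type*} [AddCommGroup V₁] [AddCommGroup V₂] (S₁ : AddSubgroup V₁)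
    (S₂ : AddSubgroup V₂) :
    Function.Injective ((AddMonoidHom.inl V₁ V₂).comp S₁.subtype) ∧
      Function.Injective ((AddMonoidHom.inr V₁ V₂).comp S₂.subtype) ∧
      ∀ (u : S₁) (w : S₂), (AddMonoidHom.inl V₁ V₂).comp S₁.subtype u +
        (AddMonoidHom.inr V₁ V₂).comp S₂.subtype w = ((u : V₁), (w : V₂)) := by
  refine ⟨fun a b h ↦ ?_, fun a b h ↦ ?_, fun u w ↦ ?_⟩
  · exact Subtype.ext (by simpa using congrArg Prod.fst h)
  · exact Subtype.ext (by simpa using congrArg Prod.snd h)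
  · simp

end Summit.BirchSwinnertonDyer.BirchSwinnertonDyer.Theorems.KolyvaginPairDataTwo

end
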